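import Summits.QuantumFields.YangMills.Theorems.LuscherReductionTwistedTraceScalingCovariantCurl
import Summits.QuantumFields.YangMills.Theorems.LuscherReductionTwistedTraceScalingQuaternionStep
import HarnessLib

/-!
# Brick c1 of the covariant Laplace step: `F_p(W·U) = F_p(U) + (D_U w)_p + O(τ² + τ·|F_p(U)|)` componentwise
# (lane B of S-BASE, crux `TwistedTraceScaling` stmt-QuantumFields-20203; covariant reformulation, blueprint §5)

Assembly of `…CovariantCurl.hol_mul_eq_transportStep_mul` (exact transport identity), `…CovariantCurl.sum_vecPart_factors_eq_covCurl` (the linear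
part is the covariant curl of `w = linkVec W`) and the quaternion estimates of `…QuaternionStep` (four near-identity factors; step × holonomy):
for a kinetic step `W` with `u₀(W_e) ≥ 0`, `|vecPart(W_e)_c| ≤ τ ≤ 1/30` on the four links of `p`, and a holonomy in the upper hemisphere with
`|F_p(U)_c| ≤ φ`, every colour component of `F_p(W·U) − F_p(U) − (D_U w)_p` is `≤ 288τ² + 1728τ²φ + 72τφ² + 48τφ` (`abs_plaqCurv_mul_sub_covCurl_le`).
Also `|adRot(V)_{ab}| ≤ 1` and `|(adRot(V)v)_c| ≤ 3·max|v|`.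
HONEST FRAMING: algebra; femto rung R2b1 (stub of a child of a CONDITIONAL route); not a gap, not Clay.
-/

set_option autoImplicit false

noncomputable section

open scoped Matrix BigOperators
open Literature.MathematicalPhysics.QuantumFieldTheory
open Literature.MathematicalPhysics.QuantumLattice

namespace Summit.QuantumFields.YangMills.Theorems.FemtoTransferGap.TwoLattice.Cov

open Summit.QuantumFields.YangMills.Theorems.FemtoTransferGap
open Summit.QuantumFields.YangMills.Theorems.FemtoTransferGap.TwoLattice
open Summit.QuantumFields.YangMills.Theorems.FemtoTransferGap.TwoLattice.Stiff

variable {L : ℕ} [NeZero L]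

/-! ## §1 Entries of `adRot` and components of transported vectors -/

/-- `|Ad(V)_{ab}| ≤ 1` (columns of an orthogonal matrix are unit vectors). [cite: BrockerTomDieck1985, I (1.10)] -/
theorem abs_adRot_le_one (V : SU2) (a b : Fin 3) : |adRot V a b| ≤ 1 := by
  have h := congrFun (congrFun (adRot_transpose_mul_self V) b) b
  simp only [Matrix.mul_apply, Matrix.transpose_apply, Matrix.one_apply_eq] at h
  have hle : adRot V a b * adRot V a b ≤ ∑ x, adRot V x b * adRot V x b :=
    Finset.single_le_sum (f := fun x => adRot V x b * adRot V x b) (fun x _ => mul_self_nonneg _) (Finset.mem_univ a)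
  rw [h] at hle
  rw [abs_le]; constructor <;> nlinarith [hle]

/-- `|(Ad(V)v)_c| ≤ 3τ` when `|v_b| ≤ τ`. [folklore] -/
theorem abs_adRot_mulVec_le (V : SU2) {v : Fin 3 → ℝ} {τ : ℝ} (hv : ∀ b, |v b| ≤ τ) (c : Fin 3) : |(adRot V).mulVec v c| ≤ 3 * τ := by
  have h : ∀ b, |adRot V c b * v b| ≤ τ := fun b => by
    rw [abs_mul]
    calc |adRot V c b| * |v b| ≤ 1 * |v b| := mul_le_mul_of_nonneg_right (abs_adRot_le_one V c b) (abs_nonneg _)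
      _ ≤ τ := by rw [one_mul]; exact hv b
  simp only [Matrix.mulVec, dotProduct, Fin.sum_univ_three]
  have := abs_add_le (adRot V c 0 * v 0 + adRot V c 1 * v 1) (adRot V c 2 * v 2)
  have := abs_add_le (adRot V c 0 * v 0) (adRot V c 1 * v 1)
  linarith [h 0, h 1, h 2]

/-- The conjugated factor `P W P⁻¹`: hemisphere kept, components `≤ 3τ`. [folklore] -/
theorem conj_factor_bounds (P W : SU2) (hW : 0 ≤ scalarPart W) {τ : ℝ} (hw : ∀ b, |vecPart W b| ≤ τ) :
    0 ≤ scalarPart (P * W * P⁻¹) ∧ ∀ c, |vecPart (P * W * P⁻¹) c| ≤ 3 * τ := by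
  refine ⟨by rwa [scalarPart_conj], fun c => ?_⟩
  rw [vecPart_conj]; exact abs_adRot_mulVec_le P hw c

/-- The inverted conjugated factor `(P W P⁻¹)⁻¹`: hemisphere kept, components `≤ 3τ`. [folklore] -/
theorem conj_inv_factor_bounds (P W : SU2) (hW : 0 ≤ scalarPart W) {τ : ℝ} (hw : ∀ b, |vecPart W b| ≤ τ) :
    0 ≤ scalarPart (P * W * P⁻¹)⁻¹ ∧ ∀ c, |vecPart (P * W * P⁻¹)⁻¹ c| ≤ 3 * τ := by
  refine ⟨by rw [scalarPart_inv, scalarPart_conj]; exact hW, fun c => ?_⟩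
  rw [vecPart_conj_inv, Pi.neg_apply, abs_neg]; exact abs_adRot_mulVec_le P hw c

/-! ## §2 The curvature after a kinetic step -/

omit [NeZero L] in
/-- ★ **BRICK c1.**  Let `p` be a plaquette, `W` a kinetic step with `u₀(W_e) ≥ 0` and `|vecPart(W_e)_c| ≤ τ ≤ 1/30` on its four links, and
`u₀(hol_p U) ≥ 0`, `|F_p(U)_c| ≤ φ`.  Then for every colour `c`:
`|F_p(W·U)_c − F_p(U)_c − (D_U (linkVec W))_{p,c}| ≤ 288τ² + 1728τ²φ + 72τφ² + 48τφ`. [cite: Luscher1983, §3] -/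
theorem abs_plaqCurv_mul_sub_covCurl_le (W U : GaugeConfig 3 L SU2) (p : Plaquette 3 L) {τ φ : ℝ} (hτ : τ ≤ 1 / 30)
    (hs : ∀ e : Edge 3 L, 0 ≤ scalarPart (W e)) (hw : ∀ (e : Edge 3 L) (c : Fin 3), |vecPart (W e) c| ≤ τ)
    (hH : 0 ≤ scalarPart (hol U p)) (hF : ∀ c, |vecPart (hol U p) c| ≤ φ) (c : Fin 3) :
    |plaqCurv (W * U) (p, c) - plaqCurv U (p, c) - covCurl U (linkVec L W) (p, c)| ≤
      288 * τ ^ 2 + 1728 * τ ^ 2 * φ + 72 * τ * φ ^ 2 + 48 * τ * φ := by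
  have hτ0 : 0 ≤ τ := (abs_nonneg _).trans (hw (p.1, p.2.1.1) 0)
  -- the four factors
  set A₁ := W (p.1, p.2.1.1) with hA₁
  set A₂ := ptrans1 U p * W (p.1.shift p.2.1.1, p.2.1.2) * (ptrans1 U p)⁻¹ with hA₂
  set A₃ := (ptrans2 U p * W (p.1.shift p.2.1.2, p.2.1.1) * (ptrans2 U p)⁻¹)⁻¹ with hA₃
  set A₄ := (hol U p * W (p.1, p.2.1.2) * (hol U p)⁻¹)⁻¹ with hA₄
  have hX : transportStep W U p = A₁ * (A₂ * (A₃ * A₄)) := by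
    simp only [transportStep, hA₁, hA₂, hA₃, hA₄, mul_assoc]
  have h1s : 0 ≤ scalarPart A₁ := hs _
  have h1v : ∀ b, |vecPart A₁ b| ≤ 3 * τ := fun b => (hw _ b).trans (by linarith)
  obtain ⟨h2s, h2v⟩ := conj_factor_bounds (ptrans1 U p) (W (p.1.shift p.2.1.1, p.2.1.2)) (hs _) (hw _)
  obtain ⟨h3s, h3v⟩ := conj_inv_factor_bounds (ptrans2 U p) (W (p.1.shift p.2.1.2, p.2.1.1)) (hs _) (hw _)
  obtain ⟨h4s, h4v⟩ := conj_inv_factor_bounds (hol U p) (W (p.1, p.2.1.2)) (hs _) (hw _)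
  have ht : 3 * τ ≤ 1 / 10 := by linarith
  obtain ⟨dX, bX, sX, -⟩ := abs_vecPart_prod4_sub_sum_le h1s h2s h3s h4s ht h1v h2v h3v h4v
  -- the step times the holonomy
  have hstep := abs_vecPart_step_hol_sub_le sX hH bX hF c
  -- the linear part is the covariant curl
  have hlin := sum_vecPart_factors_eq_covCurl W U p c
  rw [← hA₁, ← hA₂, ← hA₃, ← hA₄] at hlin
  -- assemble
  have hF' : plaqCurv (W * U) (p, c) = vecPart (A₁ * (A₂ * (A₃ * A₄)) * hol U p) c := by
    rw [plaqCurv_apply, hol_mul_eq_transportStep_mul, hX]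
  rw [hF', plaqCurv_apply, ← hlin]
  have e : vecPart (A₁ * (A₂ * (A₃ * A₄)) * hol U p) c - vecPart (hol U p) c -
      (vecPart A₁ c + vecPart A₂ c + vecPart A₃ c + vecPart A₄ c) =
      (vecPart (A₁ * (A₂ * (A₃ * A₄)) * hol U p) c - vecPart (hol U p) c - vecPart (A₁ * (A₂ * (A₃ * A₄))) c) +
        (vecPart (A₁ * (A₂ * (A₃ * A₄))) c - (vecPart A₁ c + vecPart A₂ c + vecPart A₃ c + vecPart A₄ c)) := by ring
  rw [e]
  have := abs_add_le (vecPart (A₁ * (A₂ * (A₃ * A₄)) * hol U p) c - vecPart (hol U p) c - vecPart (A₁ * (A₂ * (A₃ * A₄))) c)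
    (vecPart (A₁ * (A₂ * (A₃ * A₄))) c - (vecPart A₁ c + vecPart A₂ c + vecPart A₃ c + vecPart A₄ c))
  have hφ0 : 0 ≤ φ := (abs_nonneg _).trans (hF 0)
  nlinarith [dX c, hstep, mul_nonneg hτ0 hφ0, sq_nonneg τ, sq_nonneg φ, mul_nonneg (mul_nonneg hτ0 hτ0) hφ0, mul_nonneg (mul_nonneg hφ0 hφ0) hτ0]

end Summit.QuantumFields.YangMills.Theorems.FemtoTransferGap.TwoLattice.Cov

end
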